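import Mathlib
import HarnessLib
import Summits.HubbardSuperconductivity.HubbardSuperconductivity.Theorems.KLProgrammeKLRegimeSplitEngineV4

/-!
# Route `KLProgramme` — crux K3 split: the V4 engine slot only WEAKENS the V3 one (`engineBoundsAtV4_of_v3`)
# (cell gate-hubbard-kl, seat p1 = C1 lead, g5)

`EngineBoundsAtV3 … n → EngineBoundsAtV4 … n` for every well-formed `G` (`0 ≤ G.CF`): (E1-v4) drops the `p = 1` line of (E1-v3) and keeps the
others verbatim (`max 1 (p-1) = p-1` for `p ≥ 2`); the three increment/ladder clauses of V4 add the nonnegative `thermalBar` / `legDressBar` terms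
to the V3 remainders.  So an engine prover who establishes the sharper V3 clauses has the V4 slot of the bundle `klPredsV4` for free.
-/

noncomputable section

namespace Summit.HubbardSuperconductivity.HubbardSuperconductivity.Theorems.KLRegimeSplit

set_option linter.dupNamespace false -- summit = problem name (single-conjunct summit), D-0017

open Real Finset Literature.MathematicalPhysics.QuantumLattice Literature.Probability.LatticeModels

section Model

variable (L M : ℕ) [NeZero L] [NeZero M]

omit [NeZero M] in
/-- (E1-v3) implies (E1-v4). -/
theorem kernelNormsV4_of_v3 (P : SplitConsts) (Q : EngConsts) {β U μ : ℝ} {K : TrigPolyC4v} {n : ℕ}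
    (h : KernelNormsV3 L M P Q β U μ K n) : KernelNormsV4 L M P Q β U μ K n := by
  intro p hp
  have h' := h p (by omega)
  rwa [show max 1 (p - 1) = p - 1 by omega] at h'

/-- (E2″-v2) implies (E2″-v4). -/
theorem pairValueIncrementAtV4_of_v2 {G : GeoConsts} (hG : 0 ≤ G.CF) (P : SplitConsts) (Q : EngConsts) {β U μ : ℝ}
    {K : TrigPolyC4v} {n : ℕ} (h : PairValueIncrementAt L M G P Q β U μ K n) : PairValueIncrementAtV4 L M G P Q β U μ K n := by
  intro hn Qm k hk k' hk'
  have h' := h hn Qm k hk k' hk'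
  have h1 := thermalBar_nonneg hG P U β n
  have h2 := legDressBar_nonneg hG P U (legSliceCount L μ K n ![k', Qm - k', Qm - k, k])
  simp only [klTorusNorm] at *
  linarith

/-- (E2′-v3) implies (E2′-v4). -/
theorem quarticValueIncrementAtV4_of_v3 {G : GeoConsts} (hG : 0 ≤ G.CF) (P : SplitConsts) (Q : EngConsts) {β U μ : ℝ}
    {K : TrigPolyC4v} {n : ℕ} (h : QuarticValueIncrementAt L M G P Q β U μ K n) :
    QuarticValueIncrementAtV4 L M G P Q β U μ K n := by
  intro hn σ σ' k₁ hk₁ k₂ hk₂ k₃ hk₃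
  have h' := h hn σ σ' k₁ hk₁ k₂ hk₂ k₃ hk₃
  have h1 := thermalBar_nonneg hG P U β n
  have h2 := legDressBar_nonneg hG P U (legSliceCount L μ K n ![k₁, k₂, k₃, k₁ - k₂ + k₃])
  linarith

/-- **The V3 engine slot implies the V4 one** (for `0 ≤ G.CF`, part of `G.WF`). -/
theorem engineBoundsAtV4_of_v3 {G : GeoConsts} (hG : 0 ≤ G.CF) (P : SplitConsts) (Q : EngConsts) {β U μ : ℝ}
    {K : TrigPolyC4v} {n : ℕ} (h : EngineBoundsAtV3 L M G P Q β U μ K n) : EngineBoundsAtV4 L M G P Q β U μ K n := by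
  obtain ⟨h0, h1, h2, h2'', h2', huv, h4, h5⟩ := h
  exact ⟨h0, kernelNormsV4_of_v3 L M P Q h1, pairLadderStepAtV4_of_v3 L M hG h2, pairValueIncrementAtV4_of_v2 L M hG P Q h2'',
    quarticValueIncrementAtV4_of_v3 L M hG P Q h2', huv, h4, h5⟩

end Model

end Summit.HubbardSuperconductivity.HubbardSuperconductivity.Theorems.KLRegimeSplit

end
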